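import Summits.QuantumFields.BalabanUV.T4Continuum.Support.NE7MinimalOrbitUniqueGeneric
import Summits.QuantumFields.BalabanUV.T4Continuum.Support.AveragingDeficitKDatum
import HarnessLib

/-!
# NE7CriticalOrbitUniqueGeneric — [Balaban1985Variational] THEOREM 1's UNIQUENESS CLAUSE AS PRINTED: «THIS ORBIT IS A UNIQUE CRITICAL ORBIT IN THE SPACE (6)» — for every `U(n)`,
# every `L ≥ 2`, `d = 4`, over the small data and at every level: (i) every constrained minimiser of `sfClass 4 L N ε` is a CRITICAL point of the constrained problem (the Wilson
# action is stationary along every periodic `𝔲(n)` direction tangent to the constraint manifold `{average = V}`); (ii) conversely EVERY critical point of the constrained problem in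
# the class is a minimiser, and a periodic unitary gauge copy of any fixed minimiser — so the set of critical orbits in the space (6) is exactly ONE orbit, the minimal one

Cell `pub-balaban`, rung (B)+1 sub-cell t4, lineage `b2b-balaban-t4-ne7-p1` (CRUX PROVER NE7 #1 = OWNER of BINDER row NE7), generation 113.  Memo
`t4/b2b-balaban-t4-ne7-p1-g113/ROAD-G113.md` §1.  Over gen 109's ✓ p810527 `NE7MinimalOrbitUniqueGeneric.minimal_orbit_unique_generic` (uniqueness of the MINIMAL orbit), whose
capstone ✓ p817856 `NE7B11Thm1ForMinimisers` recorded «print's stronger «unique CRITICAL orbit in (6)» is NOT claimed».  It is claimed and proved here.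
THE ARGUMENT.  Gen 109's coercivity lemma `NE7ConvOneStepGenericSliceTangent.vary_eq_self_of_tanCritical_rep_generic` asks of its CENTRE only: admissible in the `ε`-class and
TANGENT-CRITICAL; of its COMPETITOR only: admissible with no larger action.  The pair decomposition `NE7PairDecompNL0Generic.decomp_of_nl0_pair_generic` is symmetric (both
configurations merely admissible).  So the roles are SWAPPED: centre := the critical point `U′`, competitor := a minimiser `U♯` (action `≤` that of `U′` by minimality); the lemma
gives `(U♯)^{u} = U′·e^{X}` with `X = 0`, i.e. `U′ = (U♯)^{u}` — `U′` is in the minimal orbit, hence itself a minimiser (gauge invariance of the action).  Conversely every minimiser is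
interior with relative radius `ε∕4` (✓ p810372 `NE7AllMinimisersSmallGeneric.all_minimisers_small_generic`), hence tangent-critical (`NE7OpenOfMinimisation.tanCritical_of_isMinimiser`,
Fermat on the constraint manifold).  Level `0`: the only admissible configuration is the datum.
CRITICALITY (no new definition): «`U` is a critical point of the level-`(j+1)` constrained problem» := `∀ φ`, `IsSkewDir φ → IsPeriodicDir φ (N·L^{j+1}) → TangentIter L j U φ →
dAction U φ (perWin 4 (N·L^{j+1})) = 0` — stationarity of the Wilson action of the period along every periodic `𝔲(n)` direction in the kernel of the differential of the `(j+1)`-fold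
averaging map (`AveragingDeficitMultiLevelPrep.TangentIter`), i.e. along the tangent space of the constraint manifold (a submersion on the small field, [Balaban1985Variational] §E);
this is the shape `tanCritical_of_isMinimiser` concludes and `vary_eq_self_of_tanCritical_rep_generic` consumes.
WHAT ([folklore]; 0 def, 0 sorry; `d = 4`, every `U(n)`, every `L ≥ 2`).  **`critical_orbit_unique_generic`**: `∃ ε₀ > 0, ∀ 0 < ε ≤ ε₀, ∀ N ≥ 1, ∃ δ_V > 0, ∀ V (unitary, N-periodic,
SmallField V δ_V), ∀ k, ∃ U♯, IsMinimiser 4 (sfClass 4 L N ε) L N k V U♯ ∧ ∀ U′ ∈ admissible (sfClass 4 L N ε) L k V, (k = j+1 → U′ critical at level j+1) → IsMinimiser … U′ ∧ ∃ u,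
IsUnitarySite u ∧ IsPeriodicSite u (N·L^k) ∧ gaugeAct u U′ = U♯`.  **`tanCritical_of_isMinimiser_smallData`**: every minimiser at level `j+1` is critical.
**`critical_iff_minimiser_generic`**: at level `j+1`, for admissible `U′`: critical ↔ minimiser (common thresholds).
DICTIONARY WITH PRINT (Thm 1 p. 279): «This orbit is a unique critical orbit in the space (6) if B₃ε₁ ≤ ε₀ ≤ a₀» — ours: the space (6) = `admissible (sfClass 4 L N ε) L k V` (average
`= V`, plaquettes within `ε∕M²` of `1`, unitary, periodic), data `V` in the small data of radius `δ_V(n, L, ε, N)`; everywhere-small-field case (`Ω_j = T`).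
HONEST FRAMING (page 1): composition of landed kernel theorems of this lineage (gens 90–112) and [B7]∕[B8]∕[B11] AS TYPED; nothing of Bałaban's asserted as an axiom and NOT his method
(Sect. E's contraction argument); finite 4-torus, small data, constants existential; NOT NE7 as a spine node (dagwriter∕referees' call), NOT NE3; spine 0∕9; NOT infinite volume, NOT
mass gap, NOT BetaPertH, NOT Clay (continuum YM on T⁴ ⇐ BetaPertH ∧ nine spine estimates).
-/

set_option autoImplicit false

open scoped BigOperators Matrix Matrix.Norms.L2Operator
open NormedSpace Finset Set

namespace Summit.QuantumFields.BalabanUV.T4Continuum.NE7CriticalOrbitUniqueGeneric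

open Literature.MathematicalPhysics.QuantumFieldTheory.Balaban1983to89
open B7Prop1Explicit B7Prop2Explicit
open T4AveragingDeficitWall (IsUnitaryCfg IsSkewDir SmallField vary curl curlSq dirSq)
open T4AveragingDeficitWallBoundary (IsPeriodicCfg periodBox)
open AveragingDeficitPeriodicCounting (IsPeriodicDir)
open AveragingDeficitMultiLevelPrep (LevelSmall TangentIter)
open MinimalActionLevels (perWin levelAction)
open MinimalActionSandwich (IsMinimiser admissible)
open MinimalActionRate (sfClass)
open NE3HessForm (dAction)
open NE3SlicePoincareShape (SlicePoincare slicePoincare_mono)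
open NE3EnergyShapes (IsUnitarySite IsPeriodicSite gaugeAct_one)
open NE3EnergyWeightedShapes (energyNormW)
open NE7MeanZeroGaugeSliceW (energyBlockLandauW)
open NE7ConvOneStepGenericSlice (hT_energyBlockLandau)
open NE7ConvOneStepGenericSliceTangent (vary_eq_self_of_tanCritical_rep_generic)
open NE7OpenOfMinimisation (tanCritical_of_isMinimiser)
open NE7HintUnconditionalGeneric (hint_small_data_generic)
open NE7PairDecompNL0Generic (decomp_of_nl0_pair_generic)
open NE7EnergyRateWGeneric (line_of_small_card kfree_coercivity_card)
open NE7EnergyClassPoincareGeneric (classPackage)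
open NE7EtaMinimiserGaugeCovariance (levelAction_gaugeAct isUnitarySite_inv isPeriodicSite_inv)
open BlockAverageCurrent (smallField_gaugeAct)
open NE7AllMinimisersSmallGeneric (admissible_mono_radius eq_of_admissible_zero all_minimisers_small_generic)
open AveragingDeficitKDatum (gaugeAct_inv_gaugeAct)

noncomputable section

variable {n : Type} [Fintype n] [DecidableEq n]

/-! ## §1 Every minimiser is a critical point of the constrained problem (over the small data) -/

/-- **MINIMISERS ARE CRITICAL**: over the small data, every constrained minimiser of `sfClass 4 L N ε` at level `j+1` is a critical point of the constrained problem — the Wilson action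
of the period is stationary along every periodic `𝔲(n)` direction tangent to the constraint manifold (every minimiser is interior with relative radius `ε∕4`, then Fermat on the
constraint manifold). [folklore] -/
theorem tanCritical_of_isMinimiser_smallData [Nonempty n] {L : ℕ} (hL : 2 ≤ L) :
    ∃ ε₀ : ℝ, 0 < ε₀ ∧ ∀ ε : ℝ, 0 < ε → ε ≤ ε₀ → ∀ (N : ℕ) [NeZero N], 1 ≤ N →
      ∃ δV : ℝ, 0 < δV ∧
        ∀ V ∈ {V : Site 4 → Fin 4 → (Matrix n n ℂ)ˣ | IsUnitaryCfg V ∧ IsPeriodicCfg V (N : ℤ) ∧ SmallField V δV},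
        ∀ (j : ℕ) (U : Site 4 → Fin 4 → (Matrix n n ℂ)ˣ), IsMinimiser 4 (sfClass 4 L N ε) L N (j + 1) V U →
          ∀ φ : Site 4 → Fin 4 → Matrix n n ℂ, IsSkewDir φ → IsPeriodicDir φ ((N * L ^ (j + 1) : ℕ) : ℤ) → TangentIter L j U φ →
            dAction U φ (perWin 4 (N * L ^ (j + 1))) = 0 := by
  haveI : NeZero L := ⟨by omega⟩
  have hL1 : 1 ≤ L := by omega
  have hL0 : (0 : ℝ) < L := by exact_mod_cast (show 0 < L by omega)
  obtain ⟨ε₁, hε₁, H⟩ := all_minimisers_small_generic (n := n) hL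
  obtain ⟨θ₀, CF, CE, hθ₀, -, -, -, -, -, hlsP, -, -⟩ := classPackage (n := n) (d := 4) (by norm_num) hL
  refine ⟨min ε₁ θ₀, lt_min hε₁ hθ₀, fun ε hε hεle N _ hN => ?_⟩
  have hεε₁ : ε ≤ ε₁ := hεle.trans (min_le_left _ _)
  have hεθ₀ : ε ≤ θ₀ := hεle.trans (min_le_right _ _)
  have hls : ∀ j : ℕ, LevelSmall 4 L j (ε / ((L : ℝ) ^ (j + 1)) ^ 2) := hlsP hε.le hεθ₀
  obtain ⟨δ₁, hδ₁, hsm⟩ := H ε hε hεε₁ N hN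
  refine ⟨δ₁, hδ₁, fun V hV j U hU => ?_⟩
  have hUa : SmallField U ((ε / 4) / ((L : ℝ) ^ (j + 1)) ^ 2) := hsm V hV (j + 1) U hU
  have hM0 : (0 : ℝ) < ((L : ℝ) ^ (j + 1)) ^ 2 := by positivity
  have haε : (ε / 4) / ((L : ℝ) ^ (j + 1)) ^ 2 < ε / ((L : ℝ) ^ (j + 1)) ^ 2 :=
    div_lt_div_of_pos_right (by linarith) hM0
  exact tanCritical_of_isMinimiser hL1 hN hU (by positivity) haε hUa (hls j)

/-! ## §2 Every critical point of the constrained problem is in the minimal orbit -/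

set_option maxHeartbeats 800000 in
/-- **THE MINIMAL ORBIT IS THE UNIQUE CRITICAL ORBIT IN THE SPACE (6), EVERY `U(n)`, EVERY `L ≥ 2`, `d = 4`** (statement and argument in the file header): over the small data and
at every level `k` there is a minimiser `U♯`, and every admissible configuration of the `ε`-class that is a critical point of the constrained problem (at level `k = j+1`; at level
`0` the admissible set is the datum alone) is a minimiser and a periodic unitary gauge copy of `U♯`. [folklore] -/
theorem critical_orbit_unique_generic [Nonempty n] {L : ℕ} (hL : 2 ≤ L) :
    ∃ ε₀ : ℝ, 0 < ε₀ ∧ ∀ ε : ℝ, 0 < ε → ε ≤ ε₀ → ∀ (N : ℕ) [NeZero N], 1 ≤ N →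
      ∃ δV : ℝ, 0 < δV ∧
        ∀ V ∈ {V : Site 4 → Fin 4 → (Matrix n n ℂ)ˣ | IsUnitaryCfg V ∧ IsPeriodicCfg V (N : ℤ) ∧ SmallField V δV},
        ∀ k : ℕ, ∃ Us : Site 4 → Fin 4 → (Matrix n n ℂ)ˣ, IsMinimiser 4 (sfClass 4 L N ε) L N k V Us ∧
          ∀ U' ∈ admissible (sfClass 4 L N ε) L k V,
            (∀ j : ℕ, k = j + 1 → ∀ φ : Site 4 → Fin 4 → Matrix n n ℂ, IsSkewDir φ → IsPeriodicDir φ ((N * L ^ (j + 1) : ℕ) : ℤ) →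
                TangentIter L j U' φ → dAction U' φ (perWin 4 (N * L ^ (j + 1))) = 0) →
            IsMinimiser 4 (sfClass 4 L N ε) L N k V U' ∧
              ∃ u : Site 4 → (Matrix n n ℂ)ˣ, IsUnitarySite u ∧ IsPeriodicSite u ((N * L ^ k : ℕ) : ℤ) ∧ gaugeAct u U' = Us := by
  haveI : NeZero L := ⟨by omega⟩
  have hL1 : 1 ≤ L := by omega
  have hL0 : (0 : ℝ) < L := by exact_mod_cast (show 0 < L by omega)
  obtain ⟨ε₁, hε₁, H⟩ := hint_small_data_generic (n := n) hL
  obtain ⟨ε₂, hε₂, CS, hCS, νc, hνc, κc, hκc, hdec⟩ := decomp_of_nl0_pair_generic (n := n) hL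
  obtain ⟨θ₀, CF, CE, hθ₀, -, -, hCE, -, -, hlsP, -, hPE⟩ := classPackage (n := n) (d := 4) (by norm_num) hL
  -- the k-free line with the Poincaré constant `C_E + 1` (verbatim from gen 109)
  obtain ⟨CP, hCP⟩ : ∃ CP : ℝ, CP = CE + 1 := ⟨_, rfl⟩
  have hCP1 : 1 ≤ CP := by rw [hCP]; linarith
  have hCP0 : 0 < CP := by linarith
  obtain ⟨Q, hQ⟩ : ∃ Q : ℝ, Q = 2 * (1 + CP) := ⟨_, rfl⟩
  have hQ4 : 4 ≤ Q := by rw [hQ]; linarith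
  have hQ0 : 0 < Q := by linarith
  obtain ⟨cL, hcL⟩ : ∃ cL : ℝ, cL = 2 * κc + νc ^ 2 + 2304 * (CS ^ 2 * Real.exp (2 * CS)) + 112 * (1 + 7 * CS ^ 2) + 1 := ⟨_, rfl⟩
  have hcL0 : 0 < cL := by rw [hcL]; positivity
  have hcard1 : (1 : ℝ) ≤ (Fintype.card n : ℝ) := by exact_mod_cast Fintype.card_pos
  have hcard0 : (0 : ℝ) < (Fintype.card n : ℝ) := by linarith
  obtain ⟨ε₃, hε₃⟩ : ∃ ε₃ : ℝ, ε₃ = (1 / 2) / Q / 4 / (Fintype.card n : ℝ) / cL := ⟨_, rfl⟩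
  have hε₃0 : 0 < ε₃ := by rw [hε₃]; positivity
  have hcard : (0 : ℝ) < 1000000000000000000000 * (L : ℝ) ^ 6 * (Fintype.card n : ℝ) := by positivity
  refine ⟨min ε₁ (min ε₂ (min θ₀ (min (1 / (1000000000000000000000 * (L : ℝ) ^ 6 * (Fintype.card n : ℝ))) (min ε₃ 1)))),
    lt_min hε₁ (lt_min hε₂ (lt_min hθ₀ (lt_min (by positivity) (lt_min hε₃0 one_pos)))), ?_⟩
  intro ε hε hεle N _ hN
  have hεε₁ : ε ≤ ε₁ := hεle.trans (min_le_left _ _)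
  have hεε₂ : ε ≤ ε₂ := hεle.trans ((min_le_right _ _).trans (min_le_left _ _))
  have hεθ₀ : ε ≤ θ₀ := hεle.trans ((min_le_right _ _).trans ((min_le_right _ _).trans (min_le_left _ _)))
  have hεθ : ε ≤ 1 / (1000000000000000000000 * (L : ℝ) ^ 6 * (Fintype.card n : ℝ)) :=
    hεle.trans ((min_le_right _ _).trans ((min_le_right _ _).trans ((min_le_right _ _).trans (min_le_left _ _))))
  have hεε₃ : ε ≤ ε₃ := hεle.trans ((min_le_right _ _).trans ((min_le_right _ _).trans ((min_le_right _ _).trans ((min_le_right _ _).trans (min_le_left _ _)))))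
  have hε1 : ε ≤ 1 := hεle.trans ((min_le_right _ _).trans ((min_le_right _ _).trans ((min_le_right _ _).trans ((min_le_right _ _).trans (min_le_right _ _)))))
  have hθline : 1000000000000000000000 * (L : ℝ) ^ 6 * (Fintype.card n : ℝ) * ε ≤ 1 := by
    rw [le_div_iff₀ hcard] at hεθ; linarith
  have hsmall : cL * ε ≤ (1 / 2) / Q / 4 / (Fintype.card n : ℝ) := by
    have h1 : cL * ε ≤ cL * ε₃ := mul_le_mul_of_nonneg_left hεε₃ hcL0.le
    have h2 : cL * ε₃ = (1 / 2) / Q / 4 / (Fintype.card n : ℝ) := by rw [hε₃]; field_simp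
    linarith only [h1, h2]
  have hline := line_of_small_card (c := (Fintype.card n : ℝ)) hQ4 hcard1 hCS hε hε1 (by rw [← hcL]; exact hsmall)
  have hls : ∀ j : ℕ, LevelSmall 4 L j (ε / ((L : ℝ) ^ (j + 1)) ^ 2) := hlsP hε.le hεθ₀
  -- the 𝒯_E instances of (hT) and (hP) from the class package
  have hT : ∀ (j : ℕ) (W : Site 4 → Fin 4 → (Matrix n n ℂ)ˣ), W ∈ sfClass 4 L N ε (j + 1) → ∀ F : Finset (T4AveragingDeficitWall.Plaq 4),
      (∀ φ : Site 4 → Fin 4 → Matrix n n ℂ, IsSkewDir φ → IsPeriodicDir φ ((AveragingDeficitMultiLevelPrep.tower L N (j + 1) : ℕ) : ℤ) →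
        TangentIter L j W φ → dAction W φ F = 0) →
      ∀ Y ∈ energyBlockLandauW (d := 4) (n := n) L N (j + 1) W, dAction W Y F = 0 :=
    fun j W hW F htan => hT_energyBlockLandau hL1 hε.le hls j W hW F htan
  have hP : ∀ (j : ℕ) (W : Site 4 → Fin 4 → (Matrix n n ℂ)ˣ), W ∈ sfClass 4 L N ε (j + 1) →
      SlicePoincare L (j + 1) W (energyBlockLandauW (d := 4) (n := n) L N (j + 1) W) CP (periodBox (d := 4) (N * L ^ (j + 1))) :=
    fun j W hW => slicePoincare_mono (hPE hN hε hεθ₀ j W hW) (by rw [hCP]; linarith)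
  -- the data radius: the (8)∃ minimiser of the `ε`-class (interior, hence tangent-critical)
  obtain ⟨δ₁, hδ₁, hint₁⟩ := H ε hε hεε₁ N hN
  refine ⟨δ₁, hδ₁, ?_⟩
  intro V hV k
  cases k with
  | zero =>
      -- level 0: the datum is the only admissible configuration
      obtain ⟨U₀, hU₀, -⟩ := hint₁ V hV 0
      refine ⟨U₀, hU₀, fun U' hU' _ => ?_⟩
      have hUV : U' = U₀ := by rw [eq_of_admissible_zero hU', eq_of_admissible_zero hU₀.mem]
      refine ⟨by rw [hUV]; exact hU₀, fun _ => 1, fun _ => (unitaryUnits (Matrix n n ℂ)).one_mem, fun _ _ => rfl, ?_⟩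
      rw [gaugeAct_one, hUV]
  | succ j =>
      obtain ⟨Us, hUs, a, ha0, haε, hUsa⟩ := hint₁ V hV (j + 1)
      have hM1 : (1 : ℝ) ≤ (L : ℝ) ^ (j + 1) := one_le_pow₀ (by exact_mod_cast hL1)
      refine ⟨Us, hUs, fun U' hU' hcritU' => ?_⟩
      have hcrit' : ∀ φ : Site 4 → Fin 4 → Matrix n n ℂ, IsSkewDir φ → IsPeriodicDir φ ((N * L ^ (j + 1) : ℕ) : ℤ) →
          TangentIter L j U' φ → dAction U' φ (perWin 4 (N * L ^ (j + 1))) = 0 := hcritU' j rfl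
      -- ROLE SWAP: centre := the critical point `U′`, competitor := the minimiser `U♯`
      obtain ⟨u, X, XT, XN, α, ν, κ, hu, huP, hXs, hXP, hα, hXα, hgauge, hXdec, hXT, -, hXN, hν, hNw, hN1, hαM, hνle, hκle⟩ :=
        hdec N ε hε hεε₂ hθline V j U' hU' Us hUs.mem
      -- the per-level strict line from the k-free one
      have hck := kfree_coercivity_card (c := (Fintype.card n : ℝ)) (ε := ε) hcard0 hCP0.le hM1 hν hνle hα hαM
      have hlinek : 2 * κ < ((((1 / 2 - ν ^ 2) / (2 * (1 + CP)) - ν ^ 2) / 2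
          - 576 * ((4 : ℕ) : ℝ) * (Real.exp α - 1) ^ 2 * ((L : ℝ) ^ (j + 1)) ^ 2) / (Fintype.card n : ℝ)
          - 28 * ((4 : ℕ) : ℝ) * (ε / ((L : ℝ) ^ (j + 1)) ^ 2 + 7 * α ^ 2) * ((L : ℝ) ^ (j + 1)) ^ 2) := by
        rw [hQ] at hline
        have h2κ : 2 * κ ≤ 2 * (κc * ε) := by linarith
        push_cast at hck hline ⊢
        linarith
      -- the competitor has no larger action (it is a minimiser), and its gauge copy has the same action and the same plaquette radius
      have hmin' : levelAction 4 L N (j + 1) Us ≤ levelAction 4 L N (j + 1) U' := hUs.le U' hU'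
      have hle : levelAction 4 L N (j + 1) (vary U' X 1) ≤ levelAction 4 L N (j + 1) Us := by
        rw [← hgauge, levelAction_gaugeAct]
      have h1 : SmallField (vary U' X 1) (ε / ((L : ℝ) ^ (j + 1)) ^ 2) := by
        rw [← hgauge]; exact smallField_gaugeAct hu hUs.mem.1.2.2
      obtain ⟨-, hself⟩ := vary_eq_self_of_tanCritical_rep_generic (d := 4) hL1 hN hε.le hCP0
        (fun j W => energyBlockLandauW (d := 4) (n := n) L N (j + 1) W) hT hP hU' hcrit' hmin' hXs hXP hα hXα hle h1 hXdec hXT hXN hNw hN1 hlinek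
      -- `(U♯)^{u} = U′`, so `U′^{u⁻¹} = U♯` and `U′` has the minimal action
      have hgU : gaugeAct u Us = U' := by rw [hgauge, hself]
      have hinv : gaugeAct (fun z => (u z)⁻¹) U' = Us := by rw [← hgU, gaugeAct_inv_gaugeAct]
      refine ⟨⟨hU', fun W hW => ?_⟩, fun z => (u z)⁻¹, isUnitarySite_inv hu, isPeriodicSite_inv huP, hinv⟩
      rw [← hgU, levelAction_gaugeAct]
      exact hUs.le W hW

/-! ## §3 Critical ↔ minimal, one threshold -/

/-- **CRITICAL ↔ MINIMAL IN THE SPACE (6)** (every `U(n)`, every `L ≥ 2`, `d = 4`): over the small data, at every level `j+1`, an admissible configuration of `sfClass 4 L N ε` is a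
critical point of the constrained problem iff it is a constrained minimiser; and all of them form ONE periodic unitary gauge orbit. [folklore] -/
theorem critical_iff_minimiser_generic [Nonempty n] {L : ℕ} (hL : 2 ≤ L) :
    ∃ ε₀ : ℝ, 0 < ε₀ ∧ ∀ ε : ℝ, 0 < ε → ε ≤ ε₀ → ∀ (N : ℕ) [NeZero N], 1 ≤ N →
      ∃ δV : ℝ, 0 < δV ∧
        ∀ V ∈ {V : Site 4 → Fin 4 → (Matrix n n ℂ)ˣ | IsUnitaryCfg V ∧ IsPeriodicCfg V (N : ℤ) ∧ SmallField V δV},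
        ∀ j : ℕ, (∃ Us : Site 4 → Fin 4 → (Matrix n n ℂ)ˣ, IsMinimiser 4 (sfClass 4 L N ε) L N (j + 1) V Us) ∧
          ∀ U' ∈ admissible (sfClass 4 L N ε) L (j + 1) V,
            ((∀ φ : Site 4 → Fin 4 → Matrix n n ℂ, IsSkewDir φ → IsPeriodicDir φ ((N * L ^ (j + 1) : ℕ) : ℤ) →
                TangentIter L j U' φ → dAction U' φ (perWin 4 (N * L ^ (j + 1))) = 0) ↔
              IsMinimiser 4 (sfClass 4 L N ε) L N (j + 1) V U') ∧
            (IsMinimiser 4 (sfClass 4 L N ε) L N (j + 1) V U' →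
              ∀ U'' : Site 4 → Fin 4 → (Matrix n n ℂ)ˣ, IsMinimiser 4 (sfClass 4 L N ε) L N (j + 1) V U'' →
                ∃ u : Site 4 → (Matrix n n ℂ)ˣ, IsUnitarySite u ∧ IsPeriodicSite u ((N * L ^ (j + 1) : ℕ) : ℤ) ∧ gaugeAct u U'' = U') := by
  obtain ⟨ε₁, hε₁, H1⟩ := tanCritical_of_isMinimiser_smallData (n := n) hL
  obtain ⟨ε₂, hε₂, H2⟩ := critical_orbit_unique_generic (n := n) hL
  refine ⟨min ε₁ ε₂, lt_min hε₁ hε₂, fun ε hε hεle N _ hN => ?_⟩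
  have hεε₁ : ε ≤ ε₁ := hεle.trans (min_le_left _ _)
  have hεε₂ : ε ≤ ε₂ := hεle.trans (min_le_right _ _)
  obtain ⟨δ₁, hδ₁, K1⟩ := H1 ε hε hεε₁ N hN
  obtain ⟨δ₂, hδ₂, K2⟩ := H2 ε hε hεε₂ N hN
  refine ⟨min δ₁ δ₂, lt_min hδ₁ hδ₂, fun V hV j => ?_⟩
  obtain ⟨hVu, hVP, hVδ⟩ := hV
  have hV₁ : V ∈ {V : Site 4 → Fin 4 → (Matrix n n ℂ)ˣ | IsUnitaryCfg V ∧ IsPeriodicCfg V (N : ℤ) ∧ SmallField V δ₁} :=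
    ⟨hVu, hVP, MinimalActionRate.SmallField.mono hVδ (min_le_left _ _)⟩
  have hV₂ : V ∈ {V : Site 4 → Fin 4 → (Matrix n n ℂ)ˣ | IsUnitaryCfg V ∧ IsPeriodicCfg V (N : ℤ) ∧ SmallField V δ₂} :=
    ⟨hVu, hVP, MinimalActionRate.SmallField.mono hVδ (min_le_right _ _)⟩
  obtain ⟨Us, hUs, horbit⟩ := K2 V hV₂ (j + 1)
  refine ⟨⟨Us, hUs⟩, fun U' hU' => ⟨⟨fun hc => (horbit U' hU' fun j' hj' => ?_).1, fun hm => K1 V hV₁ j U' hm⟩, fun hm U'' hm'' => ?_⟩⟩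
  · -- transport the criticality hypothesis along `j + 1 = j' + 1`
    have hjj : j' = j := by omega
    subst hjj
    exact hc
  · -- two minimisers: both are gauge copies of `U♯`, compose
    have hc' := K1 V hV₁ j U' hm
    have hc'' := K1 V hV₁ j U'' hm''
    obtain ⟨u', hu', hu'P, hg'⟩ := (horbit U' hm.mem fun j' hj' => by
      have hjj : j' = j := by omega
      subst hjj; exact hc').2
    obtain ⟨u'', hu'', hu''P, hg''⟩ := (horbit U'' hm''.mem fun j' hj' => by
      have hjj : j' = j := by omega
      subst hjj; exact hc'').2
    -- `U″^{u″} = U♯ = U′^{u′}` ⇒ `U″^{(u′)⁻¹·u″} = U′`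
    refine ⟨fun z => (u' z)⁻¹ * u'' z, fun z => (unitaryUnits (Matrix n n ℂ)).mul_mem ((unitaryUnits (Matrix n n ℂ)).inv_mem (hu' z)) (hu'' z),
      fun x i => by simp only [hu'P x i, hu''P x i], ?_⟩
    have hmul : gaugeAct (fun z => (u' z)⁻¹ * u'' z) U'' = gaugeAct (fun z => (u' z)⁻¹) (gaugeAct u'' U'') := by
      funext x μ; simp only [gaugeAct]; group
    rw [hmul, hg'', ← hg', gaugeAct_inv_gaugeAct]

end

end Summit.QuantumFields.BalabanUV.T4Continuum.NE7CriticalOrbitUniqueGeneric
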